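import Summits.ValiantsHypothesis.ValiantsHypothesis.Theorems.KPlusLogSqLawStaticPathSilentFlips
import Summits.ValiantsHypothesis.ValiantsHypothesis.Theorems.KPlusLogSqLawStaticPathGapChargingSweep
import Summits.ValiantsHypothesis.ValiantsHypothesis.Theorems.KPlusLogSqLawStaticPathEvents
import Summits.ValiantsHypothesis.ValiantsHypothesis.Theorems.KPlusLogSqLawStaticPathUnique

/-!
# Route «KPlusLogSqLaw» — parametric max-weight independent set on a path: THE SILENT-FLIP LAW `#breakpoints ≤ n + #silent flips` along every sweep

HONEST FRAMING.  Helper toward the crux `WeakLifting` (item `stmt-ValiantsHypothesis-19561`, route `KPlusLogSqLaw`, cell `pub-symmetroid`,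
seat val-sym-lift-p4 g24, 2026-08-29) on the line of its witness-plan stub `stub_tridiagonalSectorB` (tropical twin of the STATIC tridiagonal
sector = parametric maximum-weight independent set on a path; located theory `HOME/val-sym-lift-p4/SILENT-FLIP-LAW.md`, THEOREM A).
Capstone of the silent-flip files: the abstract sharp law `card_events_le_add_card_changes` (`…StaticPathSilentFlips`, two-chain processes)
is instantiated to DISCRETE SWEEPS of the prefix-sum arrangement `S_0, …, S_n` of the block `i+1, …, i+n` (parameters `θ 0, …, θ T`; between
consecutive ones exactly the pair `(S_{x k}, S_{y k})`, `x k < y k ≤ n`, reverses its order, all other pairs keep theirs; pairwise distinct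
values at every `θ k`; the pair adjacent at `θ k`; each pair acted on at most once — every allowable sequence of the arrangement, read at
generic sample points, is such a sweep):
* `leftRecord_sem` / `rightRecord_sem` — the touch sets of the alternating fold of `S_0, …, S_n` and of the reversed block's fold have the
  GREEDY RECORD SEMANTICS of the abstract calculus in the block's own coordinates: `u` is a left record iff it is incorrect (even: below, odd:
  above) with respect to its nearest left record, and a right record iff it is incorrect with respect to its nearest RIGHT record;
* **`card_events_le_add_card_silent_of_sweep`** — `#{event steps} ≤ n + #{(k, z) : z changes record status at step k}`;
* **`card_changes_le_add_card_silent_of_sweep`** — for optimal independent sets `M k` at the `θ k`: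
  `#{k < T : M k ≠ M (k+1)} ≤ n + #{(k, z) : z changes record status at step k}` — THEOREM A «#breakpoints ≤ n + #silent flips» of the memo
  in the kernel (event steps = changes of the unique optimum by `ne_iff_event` and `event_iff_records`).
Statements about a path DP; nothing here asserts anything about `WeakLifting`, `TropicalB`, `KPlusLogSqLaw`, the stub in its window,
`MatrixDescartes` (stmt-ValiantsHypothesis-18050) or `VP ≠ VNP`; the ORDER QUESTION stays open (the silent flips are not bounded here).
-/

set_option linter.dupNamespace false
set_option autoImplicit false

namespace Summit.ValiantsHypothesis.ValiantsHypothesis.Theorems.KPlusLogSqLaw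

open Finset Classical

namespace StaticPathFold

noncomputable section

/-! ## 1. The folds have the greedy record semantics -/

/-- **left records**: with pairwise distinct values, the touch set of the alternating fold has the greedy semantics (offset `0`): if `p` is the
nearest touch point left of `u`, then `u` touches iff `L u < L p` for even `u`, `L p < L u` for odd `u`. [folklore] -/
theorem leftRecord_sem (a b : ℕ → ℝ) {n : ℕ} {θ : ℝ} (hdis : ∀ p q, p ≤ n → q ≤ n → p ≠ q → L a b p θ ≠ L a b q θ) :
    ∀ p u, p < u → u ≤ n → fold a b p θ = L a b p θ → (∀ q, p < q → q < u → ¬ fold a b q θ = L a b q θ) →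
      (fold a b u θ = L a b u θ ↔ ((Even (u + 0) → L a b u θ < L a b p θ) ∧ (¬ Even (u + 0) → L a b p θ < L a b u θ))) := by
  intro p u hpu hun hp hno
  obtain ⟨k, rfl⟩ : ∃ k, u = k + 1 := ⟨u - 1, by omega⟩
  have hlab : lab a b k θ = p :=
    (lab_eq_iff_last_touch a b (by omega)).mpr ⟨hp, fun z h1 h2 => hno z h1 (by omega)⟩
  have hne := hdis (k + 1) p hun (by omega) (by omega)
  rw [Nat.add_zero, fold_succ_eq_L_iff, hlab]
  split_ifs with he
  · exact ⟨fun h => ⟨fun _ => lt_of_le_of_ne h hne, fun h' => absurd he h'⟩, fun h => (h.1 he).le⟩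
  · exact ⟨fun h => ⟨fun h' => absurd h' he, fun _ => lt_of_le_of_ne h (Ne.symm hne)⟩, fun h => (h.2 he).le⟩

/-- **right records, in the block's own coordinates**: with pairwise distinct prefix-sum values, `u < n` is a right record (the reversed block's
fold touches at level `n - u`) iff, `r` being its nearest right record, `S u < S r` for even `u` and `S r < S u` for odd `u` — the same rule as
on the left. [folklore] -/
theorem rightRecord_sem (w₁ w₀ : ℕ → ℝ) {i n : ℕ} {θ : ℝ}
    (hdis : ∀ p q, p ≤ n → q ≤ n → p ≠ q → L (altA (shift i w₁)) (altB (shift i w₀)) p θ ≠ L (altA (shift i w₁)) (altB (shift i w₀)) q θ) :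
    ∀ u r, u < r → r ≤ n →
      fold (altA (shift 0 (rev i n w₁))) (altB (shift 0 (rev i n w₀))) (n - r) θ = L (altA (shift 0 (rev i n w₁))) (altB (shift 0 (rev i n w₀))) (n - r) θ →
      (∀ q, u < q → q < r → ¬ fold (altA (shift 0 (rev i n w₁))) (altB (shift 0 (rev i n w₀))) (n - q) θ =
        L (altA (shift 0 (rev i n w₁))) (altB (shift 0 (rev i n w₀))) (n - q) θ) →
      (fold (altA (shift 0 (rev i n w₁))) (altB (shift 0 (rev i n w₀))) (n - u) θ =
          L (altA (shift 0 (rev i n w₁))) (altB (shift 0 (rev i n w₀))) (n - u) θ ↔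
        ((Even (u + 0) → L (altA (shift i w₁)) (altB (shift i w₀)) u θ < L (altA (shift i w₁)) (altB (shift i w₀)) r θ) ∧
          (¬ Even (u + 0) → L (altA (shift i w₁)) (altB (shift i w₀)) r θ < L (altA (shift i w₁)) (altB (shift i w₀)) u θ))) := by
  set A' := altA (shift 0 (rev i n w₁)) with hA'
  set B' := altB (shift 0 (rev i n w₀)) with hB'
  set Sv := L (altA (shift i w₁)) (altB (shift i w₀)) with hSv
  intro u r hur hrn hRr hno
  have hun : u ≤ n := by omega
  obtain ⟨k, hk⟩ : ∃ k, n - u = k + 1 := ⟨n - u - 1, by omega⟩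
  have hlab : lab A' B' k θ = n - r :=
    (lab_eq_iff_last_touch A' B' (by omega)).mpr ⟨hRr, fun z h1 h2 => by
      have := hno (n - z) (by omega) (by omega)
      rwa [show n - (n - z) = z by omega] at this⟩
  have hdisR := rev_ne_of_ne w₁ w₀ (n := n) hdis
  have hne : L A' B' (n - u) θ ≠ L A' B' (n - r) θ := hdisR (n - u) (n - r) (Nat.sub_le n u) (Nat.sub_le n r) (by omega)
  have hneS : Sv u θ ≠ Sv r θ := hdis u r hun hrn (by omega)
  -- strict forms of the two reversed comparisons, in the block's coordinates
  have e1 : L A' B' (n - u) θ < L A' B' (n - r) θ ↔ (-1 : ℝ) ^ (n + 1) * Sv r θ < (-1) ^ (n + 1) * Sv u θ := by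
    rw [hA', hB', rev_lt_iff w₁ w₀ (Nat.sub_le n u) (Nat.sub_le n r), show n - (n - r) = r by omega,
      show n - (n - u) = u by omega]
  have e2 : L A' B' (n - r) θ < L A' B' (n - u) θ ↔ (-1 : ℝ) ^ (n + 1) * Sv u θ < (-1) ^ (n + 1) * Sv r θ := by
    rw [hA', hB', rev_lt_iff w₁ w₀ (Nat.sub_le n r) (Nat.sub_le n u), show n - (n - r) = r by omega,
      show n - (n - u) = u by omega]
  have hpar : Even (n - u) ↔ (Even n ↔ Even u) := Nat.even_sub hun
  rw [hk, fold_succ_eq_L_iff, hlab, ← hk, Nat.add_zero]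
  split_ifs with he
  · rw [show (L A' B' (n - u) θ ≤ L A' B' (n - r) θ ↔ L A' B' (n - u) θ < L A' B' (n - r) θ) from
        ⟨fun h => lt_of_le_of_ne h hne, le_of_lt⟩, e1]
    rcases Nat.even_or_odd n with hn | hn
    · have hpow : ((-1 : ℝ)) ^ (n + 1) = -1 := Odd.neg_one_pow (Even.add_one hn)
      have hu : Even u := (hpar.mp he).mp hn
      rw [hpow, neg_one_mul, neg_one_mul, neg_lt_neg_iff]
      exact ⟨fun h => ⟨fun _ => h, fun h' => absurd hu h'⟩, fun h => h.1 hu⟩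
    · have hpow : ((-1 : ℝ)) ^ (n + 1) = 1 := Even.neg_one_pow (Odd.add_one hn)
      have hu : ¬ Even u := fun h => (Nat.not_even_iff_odd.mpr hn) ((hpar.mp he).mpr h)
      rw [hpow, one_mul, one_mul]
      exact ⟨fun h => ⟨fun h' => absurd h' hu, fun _ => h⟩, fun h => h.2 hu⟩
  · rw [show (L A' B' (n - r) θ ≤ L A' B' (n - u) θ ↔ L A' B' (n - r) θ < L A' B' (n - u) θ) from
        ⟨fun h => lt_of_le_of_ne h (Ne.symm hne), le_of_lt⟩, e2]
    rcases Nat.even_or_odd n with hn | hn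
    · have hpow : ((-1 : ℝ)) ^ (n + 1) = -1 := Odd.neg_one_pow (Even.add_one hn)
      have hu : ¬ Even u := fun h => he (hpar.mpr (iff_of_true hn h))
      rw [hpow, neg_one_mul, neg_one_mul, neg_lt_neg_iff]
      exact ⟨fun h => ⟨fun h' => absurd h' hu, fun _ => h⟩, fun h => h.2 hu⟩
    · have hpow : ((-1 : ℝ)) ^ (n + 1) = 1 := Even.neg_one_pow (Odd.add_one hn)
      have hu : Even u := by
        by_contra h
        exact he (hpar.mpr ⟨fun h' => absurd h' (Nat.not_even_iff_odd.mpr hn), fun h' => absurd h' h⟩)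
      rw [hpow, one_mul, one_mul]
      exact ⟨fun h => ⟨fun _ => h, fun h' => absurd hu h'⟩, fun h => h.1 hu⟩

/-! ## 2. The silent-flip law along a discrete sweep -/

section Sweep

variable (w₁ w₀ : ℕ → ℝ)

/-- **THE SILENT-FLIP LAW ALONG A DISCRETE SWEEP** (`HOME/val-sym-lift-p4/SILENT-FLIP-LAW.md`, THEOREM A): the number of event steps (smaller
index a left record, larger a right record, no record strictly between) is at most `n` plus the number of pairs `(k, z)`, `k < T`, `z ≤ n`, at
which `z` is a record at exactly one of `θ k`, `θ (k+1)`. [folklore] -/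
theorem card_events_le_add_card_silent_of_sweep (i n T : ℕ) (θ : ℕ → ℝ) (x y : ℕ → ℕ)
    (hxy : ∀ k, k < T → x k < y k ∧ y k ≤ n)
    (hord : ∀ k, k < T → ∀ p q, p ≤ n → q ≤ n → ¬(p = x k ∧ q = y k) → ¬(p = y k ∧ q = x k) →
      (L (altA (shift i w₁)) (altB (shift i w₀)) p (θ k) < L (altA (shift i w₁)) (altB (shift i w₀)) q (θ k) ↔
        L (altA (shift i w₁)) (altB (shift i w₀)) p (θ (k + 1)) < L (altA (shift i w₁)) (altB (shift i w₀)) q (θ (k + 1))))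
    (hdis : ∀ k, k ≤ T → ∀ p q, p ≤ n → q ≤ n → p ≠ q →
      L (altA (shift i w₁)) (altB (shift i w₀)) p (θ k) ≠ L (altA (shift i w₁)) (altB (shift i w₀)) q (θ k))
    (hadj : ∀ k, k < T → ∀ z, z ≤ n → z ≠ x k → z ≠ y k →
      (L (altA (shift i w₁)) (altB (shift i w₀)) z (θ k) < L (altA (shift i w₁)) (altB (shift i w₀)) (x k) (θ k) ↔
        L (altA (shift i w₁)) (altB (shift i w₀)) z (θ k) < L (altA (shift i w₁)) (altB (shift i w₀)) (y k) (θ k)))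
    (hflip : ∀ k, k < T →
      (L (altA (shift i w₁)) (altB (shift i w₀)) (x k) (θ k) < L (altA (shift i w₁)) (altB (shift i w₀)) (y k) (θ k) ↔
        ¬ L (altA (shift i w₁)) (altB (shift i w₀)) (x k) (θ (k + 1)) < L (altA (shift i w₁)) (altB (shift i w₀)) (y k) (θ (k + 1))))
    (honce : ∀ k, k < T → ∀ k', k' < T → x k = x k' → y k = y k' → k = k') :
    ((range T).filter (fun k =>
        fold (altA (shift i w₁)) (altB (shift i w₀)) (x k) (θ k) = L (altA (shift i w₁)) (altB (shift i w₀)) (x k) (θ k) ∧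
          fold (altA (shift 0 (rev i n w₁))) (altB (shift 0 (rev i n w₀))) (n - y k) (θ k) =
            L (altA (shift 0 (rev i n w₁))) (altB (shift 0 (rev i n w₀))) (n - y k) (θ k) ∧
          ∀ z, x k < z → z < y k →
            ¬ fold (altA (shift i w₁)) (altB (shift i w₀)) z (θ k) = L (altA (shift i w₁)) (altB (shift i w₀)) z (θ k) ∧
              ¬ fold (altA (shift 0 (rev i n w₁))) (altB (shift 0 (rev i n w₀))) (n - z) (θ k) =
                L (altA (shift 0 (rev i n w₁))) (altB (shift 0 (rev i n w₀))) (n - z) (θ k))).card ≤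
      n + (((range T) ×ˢ (range (n + 1))).filter (fun kz : ℕ × ℕ =>
        ¬ ((fold (altA (shift i w₁)) (altB (shift i w₀)) kz.2 (θ kz.1) = L (altA (shift i w₁)) (altB (shift i w₀)) kz.2 (θ kz.1) ∨
              fold (altA (shift 0 (rev i n w₁))) (altB (shift 0 (rev i n w₀))) (n - kz.2) (θ kz.1) =
                L (altA (shift 0 (rev i n w₁))) (altB (shift 0 (rev i n w₀))) (n - kz.2) (θ kz.1)) ↔
            (fold (altA (shift i w₁)) (altB (shift i w₀)) kz.2 (θ (kz.1 + 1)) =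
                L (altA (shift i w₁)) (altB (shift i w₀)) kz.2 (θ (kz.1 + 1)) ∨
              fold (altA (shift 0 (rev i n w₁))) (altB (shift 0 (rev i n w₀))) (n - kz.2) (θ (kz.1 + 1)) =
                L (altA (shift 0 (rev i n w₁))) (altB (shift 0 (rev i n w₀))) (n - kz.2) (θ (kz.1 + 1)))))).card := by
  set A := altA (shift i w₁) with hA
  set B := altB (shift i w₀) with hB
  set A' := altA (shift 0 (rev i n w₁)) with hA'
  set B' := altB (shift 0 (rev i n w₀)) with hB'
  have hRn : ∀ k, k ≤ T → fold A' B' (n - n) (θ k) = L A' B' (n - n) (θ k) := fun k _ => by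
    rw [Nat.sub_self]; exact fold_zero A' B' (θ k)
  exact card_events_le_add_card_changes (fun k u => L A B u (θ k)) 0 n T x y
    (Lr := fun k u => fold A B u (θ k) = L A B u (θ k)) (Rr := fun k u => fold A' B' (n - u) (θ k) = L A' B' (n - u) (θ k))
    hxy (fun k _ => fold_zero A B (θ k)) hRn (fun k hk => leftRecord_sem A B (hdis k hk))
    (fun k hk => rightRecord_sem w₁ w₀ (hdis k hk)) hord hdis hadj hflip honce

/-- **THEOREM A — #BREAKPOINTS ≤ n + #SILENT FLIPS ALONG A DISCRETE SWEEP** (`HOME/val-sym-lift-p4/SILENT-FLIP-LAW.md`): if `M k` is an optimal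
independent set of the block at `θ k` for every `k ≤ T`, the number of steps at which the optimum changes is at most `n` plus the number of pairs
`(k, z)`, `k < T`, `z ≤ n`, at which `z` changes its record status. [folklore] -/
theorem card_changes_le_add_card_silent_of_sweep (i n T : ℕ) (θ : ℕ → ℝ) (x y : ℕ → ℕ) (M : ℕ → Finset ℕ)
    (hxy : ∀ k, k < T → x k < y k ∧ y k ≤ n)
    (hord : ∀ k, k < T → ∀ p q, p ≤ n → q ≤ n → ¬(p = x k ∧ q = y k) → ¬(p = y k ∧ q = x k) →
      (L (altA (shift i w₁)) (altB (shift i w₀)) p (θ k) < L (altA (shift i w₁)) (altB (shift i w₀)) q (θ k) ↔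
        L (altA (shift i w₁)) (altB (shift i w₀)) p (θ (k + 1)) < L (altA (shift i w₁)) (altB (shift i w₀)) q (θ (k + 1))))
    (hdis : ∀ k, k ≤ T → ∀ p q, p ≤ n → q ≤ n → p ≠ q →
      L (altA (shift i w₁)) (altB (shift i w₀)) p (θ k) ≠ L (altA (shift i w₁)) (altB (shift i w₀)) q (θ k))
    (hadj : ∀ k, k < T → ∀ z, z ≤ n → z ≠ x k → z ≠ y k →
      (L (altA (shift i w₁)) (altB (shift i w₀)) z (θ k) < L (altA (shift i w₁)) (altB (shift i w₀)) (x k) (θ k) ↔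
        L (altA (shift i w₁)) (altB (shift i w₀)) z (θ k) < L (altA (shift i w₁)) (altB (shift i w₀)) (y k) (θ k)))
    (hflip : ∀ k, k < T →
      (L (altA (shift i w₁)) (altB (shift i w₀)) (x k) (θ k) < L (altA (shift i w₁)) (altB (shift i w₀)) (y k) (θ k) ↔
        ¬ L (altA (shift i w₁)) (altB (shift i w₀)) (x k) (θ (k + 1)) < L (altA (shift i w₁)) (altB (shift i w₀)) (y k) (θ (k + 1))))
    (honce : ∀ k, k < T → ∀ k', k' < T → x k = x k' → y k = y k' → k = k')
    (hM : ∀ k, k ≤ T → M k ∈ indepSets i n)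
    (hopt : ∀ k, k ≤ T → ∑ t ∈ M k, W w₁ w₀ t (θ k) = opt w₁ w₀ i n (θ k)) :
    ((range T).filter (fun k => M k ≠ M (k + 1))).card ≤
      n + (((range T) ×ˢ (range (n + 1))).filter (fun kz : ℕ × ℕ =>
        ¬ ((fold (altA (shift i w₁)) (altB (shift i w₀)) kz.2 (θ kz.1) = L (altA (shift i w₁)) (altB (shift i w₀)) kz.2 (θ kz.1) ∨
              fold (altA (shift 0 (rev i n w₁))) (altB (shift 0 (rev i n w₀))) (n - kz.2) (θ kz.1) =
                L (altA (shift 0 (rev i n w₁))) (altB (shift 0 (rev i n w₀))) (n - kz.2) (θ kz.1)) ↔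
            (fold (altA (shift i w₁)) (altB (shift i w₀)) kz.2 (θ (kz.1 + 1)) =
                L (altA (shift i w₁)) (altB (shift i w₀)) kz.2 (θ (kz.1 + 1)) ∨
              fold (altA (shift 0 (rev i n w₁))) (altB (shift 0 (rev i n w₀))) (n - kz.2) (θ (kz.1 + 1)) =
                L (altA (shift 0 (rev i n w₁))) (altB (shift 0 (rev i n w₀))) (n - kz.2) (θ (kz.1 + 1)))))).card := by
  set A := altA (shift i w₁) with hA
  set B := altB (shift i w₀) with hB
  set A' := altA (shift 0 (rev i n w₁)) with hA'
  set B' := altB (shift 0 (rev i n w₀)) with hB'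
  have hmain := card_events_le_add_card_silent_of_sweep w₁ w₀ i n T θ x y hxy hord hdis hadj hflip honce
  refine le_trans (Finset.card_le_card (fun k hk => ?_)) hmain
  obtain ⟨hkT, hne⟩ := mem_filter.mp hk
  rw [mem_range] at hkT
  obtain ⟨hxy1, hyn⟩ := hxy k hkT
  have huniq := unique_of_distinct w₁ w₀ (hdis k hkT.le) (hM k hkT.le) (hopt k hkT.le)
  have huniq' := unique_of_distinct w₁ w₀ (hdis (k + 1) (by omega)) (hM (k + 1) (by omega)) (hopt (k + 1) (by omega))
  obtain ⟨-, hL, hI, hR⟩ := (ne_iff_event w₁ w₀ hxy1 hyn (hM k hkT.le) (hM (k + 1) (by omega)) huniq huniq'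
    (hord k hkT) (hdis k hkT.le) (hdis (k + 1) (by omega)) (hadj k hkT)).mp hne
  obtain ⟨-, -, hno⟩ := (event_iff_records w₁ w₀ hxy1 hyn (hdis k hkT.le) (hadj k hkT)).mp ⟨hL, hI, hR⟩
  exact mem_filter.mpr ⟨mem_range.mpr hkT, hL, hR, hno⟩

end Sweep

end

end StaticPathFold

end Summit.ValiantsHypothesis.ValiantsHypothesis.Theorems.KPlusLogSqLaw
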